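import Literature.Topology.Euclidean.InvarianceOfDomain
import Mathlib.Geometry.Manifold.ChartedSpace
import Mathlib.Analysis.InnerProductSpace.PiL2
import HarnessLib

/-!
# N1-move, bridge (e×) `piece_e_cross`, tool 2: the point-set topology of a periodic box chart of a
# 3-manifold (wave 8, worker J4, brick of stub `stub_M2geo` = node N1 ▸ contract `node_N1_move_of_pieces`
# ▸ `HD` = `piece_e_cross piece_d`, line `modp-braid-orbits`, crux `ConvexBisection.AcyclicBisectionExists`,
# item stmt-SmoothPoincare4-10508; registered sub-goal `helper_boxChart_isOpen_image`)

H4's two-sided belt chart `Λ : ℝ × ℝ × ℝ → ∂X₀` (piece (d)) is, on the open box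
`B = ℝ × (−1, 1) × (−η, η)`, continuous, `1`-periodic in the first variable and injective on
`[0, 1) × (−1, 1) × (−η, η)`.  The bridge (e×) reads loops of `∂X₀` near the belt circle THROUGH `Λ`;
this file supplies the topology of such a chart of a `3`-manifold `M` (charted over `ℝ³`), from these
three clauses alone:

* §1 `box_periodic_int`, `box_eq_iff`, `box_injOn_window` — integer periodicity; two points of the box
  with the same image have the same `(r, σ)` and abscissae differing by an integer; injectivity on
  windows of width one;
* §2 **`isOpen_image_box`** — `Λ` maps open subsets of the box to OPEN subsets of `M` (in a chart of `M`
  the restriction to a window is a continuous injection between open subsets of `ℝ³`, open by Brouwer's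
  invariance of domain, `Literature.Topology.Euclidean.Brouwer.isOpen_image_of_injOn`); `image_mem_nhds_box`;
* §3 **`continuousOn_read_box`** — reading a periodic continuous function through the chart is
  continuous on the image of the box (the multivalued inverse is continuous up to the period).

Everything is proved; no definitions, no named facts, no `sorry`.  Reference: T. Tao, *Hilbert's fifth
problem and related topics* (2014), Thm. 6.0.12 [Tao2014]. [folklore]
-/

noncomputable section

set_option linter.dupNamespace false

open Set Function Filter
open scoped Topology

namespace Summit.SmoothPoincare4.SmoothPoincare4.Theorems.AcyclicBisectionExists.ModpBraidOrbits

namespace CrossBox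

variable {M : Type*} {Λ : ℝ × ℝ × ℝ → M} {η : ℝ}

/-! ## §1 Periodicity and injectivity up to the period -/

/-- A map `1`-periodic in the first variable is `ℤ`-periodic in it. [folklore] -/
theorem box_periodic_int (hΛ1 : ∀ u r σ, Λ (u + 1, r, σ) = Λ (u, r, σ)) (m : ℤ) (u r σ : ℝ) :
    Λ (u + m, r, σ) = Λ (u, r, σ) := by
  induction m using Int.induction_on generalizing u with
  | zero => simp
  | succ k ih =>
    have h := hΛ1 (u + k) r σ
    rw [add_assoc] at h
    have h' := ih u
    push_cast at h' ⊢
    rw [h, h']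
  | pred k ih =>
    have h := hΛ1 (u + (-(k : ℝ) - 1)) r σ
    rw [add_assoc, show -(k : ℝ) - 1 + 1 = -(k : ℝ) by ring] at h
    have h' := ih u
    push_cast at h' ⊢
    rw [← h, h']

/-- Reduction of the abscissa modulo `1`. [folklore] -/
theorem box_fract (hΛ1 : ∀ u r σ, Λ (u + 1, r, σ) = Λ (u, r, σ)) (p : ℝ × ℝ × ℝ) :
    Λ (Int.fract p.1, p.2.1, p.2.2) = Λ p := by
  have h := box_periodic_int hΛ1 (-⌊p.1⌋) p.1 p.2.1 p.2.2
  rw [Int.fract, sub_eq_add_neg, ← Int.cast_neg, h]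

/-- **Injectivity up to the period**: two points of the open box with the same image have the same
second and third coordinates and abscissae differing by an integer. [folklore] -/
theorem box_eq_iff (hΛ1 : ∀ u r σ, Λ (u + 1, r, σ) = Λ (u, r, σ))
    (hΛi : InjOn Λ (Ico (0 : ℝ) 1 ×ˢ (Ioo (-1 : ℝ) 1 ×ˢ Ioo (-η) η))) {p p' : ℝ × ℝ × ℝ}
    (hp : p.2 ∈ Ioo (-1 : ℝ) 1 ×ˢ Ioo (-η) η) (hp' : p'.2 ∈ Ioo (-1 : ℝ) 1 ×ˢ Ioo (-η) η)
    (h : Λ p = Λ p') : p.2 = p'.2 ∧ ∃ m : ℤ, p'.1 = p.1 + m := by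
  have e := hΛi (⟨⟨Int.fract_nonneg _, Int.fract_lt_one _⟩, hp⟩ :
      (Int.fract p.1, p.2.1, p.2.2) ∈ Ico (0 : ℝ) 1 ×ˢ (Ioo (-1 : ℝ) 1 ×ˢ Ioo (-η) η))
    (⟨⟨Int.fract_nonneg _, Int.fract_lt_one _⟩, hp'⟩ :
      (Int.fract p'.1, p'.2.1, p'.2.2) ∈ Ico (0 : ℝ) 1 ×ˢ (Ioo (-1 : ℝ) 1 ×ˢ Ioo (-η) η))
    (by rw [box_fract hΛ1, box_fract hΛ1, h])
  simp only [Prod.mk.injEq] at e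
  refine ⟨Prod.ext e.2.1 e.2.2, ⌊p'.1⌋ - ⌊p.1⌋, ?_⟩
  have h1 := Int.fract_add_floor p.1
  have h2 := Int.fract_add_floor p'.1
  push_cast
  linarith [e.1]

/-- Injectivity on a window of width one. [folklore] -/
theorem box_injOn_window (hΛ1 : ∀ u r σ, Λ (u + 1, r, σ) = Λ (u, r, σ))
    (hΛi : InjOn Λ (Ico (0 : ℝ) 1 ×ˢ (Ioo (-1 : ℝ) 1 ×ˢ Ioo (-η) η))) (u₀ : ℝ) :
    InjOn Λ (Ioo (u₀ - 1 / 2) (u₀ + 1 / 2) ×ˢ (Ioo (-1 : ℝ) 1 ×ˢ Ioo (-η) η)) := by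
  rintro p ⟨hp1, hp2⟩ p' ⟨hp1', hp2'⟩ h
  obtain ⟨h2, m, hm⟩ := box_eq_iff hΛ1 hΛi hp2 hp2' h
  have hlt : |(m : ℝ)| < 1 := by
    rw [abs_lt]; constructor <;> linarith [hp1.1, hp1.2, hp1'.1, hp1'.2]
  have hm0 : m = 0 := by
    have : |m| < 1 := by exact_mod_cast hlt
    exact Int.abs_lt_one_iff.1 this
  subst hm0
  simp only [Int.cast_zero, add_zero] at hm
  exact Prod.ext hm.symm h2

/-! ## §2 The chart is open -/

variable [TopologicalSpace M] [ChartedSpace (EuclideanSpace ℝ (Fin 3)) M]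

/-- **A periodic box chart of a `3`-manifold maps open subsets of the box to open sets** (Brouwer's
invariance of domain in a chart of `M`, on windows of width one). [cite: Tao2014, Thm. 6.0.12] -/
theorem isOpen_image_box (hΛc : ContinuousOn Λ (univ ×ˢ (Ioo (-1 : ℝ) 1 ×ˢ Ioo (-η) η)))
    (hΛ1 : ∀ u r σ, Λ (u + 1, r, σ) = Λ (u, r, σ))
    (hΛi : InjOn Λ (Ico (0 : ℝ) 1 ×ˢ (Ioo (-1 : ℝ) 1 ×ˢ Ioo (-η) η))) {O : Set (ℝ × ℝ × ℝ)}
    (hO : IsOpen O) (hOB : O ⊆ univ ×ˢ (Ioo (-1 : ℝ) 1 ×ˢ Ioo (-η) η)) : IsOpen (Λ '' O) := by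
  rw [isOpen_iff_mem_nhds]
  rintro _ ⟨p₀, hp₀, rfl⟩
  -- the chart of `M` at `Λ p₀` and the window around `p₀`, cut down to the chart domain
  set c := chartAt (EuclideanSpace ℝ (Fin 3)) (Λ p₀) with hc_def
  set W : Set (ℝ × ℝ × ℝ) :=
    (Ioo (p₀.1 - 1 / 2) (p₀.1 + 1 / 2) ×ˢ (Ioo (-1 : ℝ) 1 ×ˢ Ioo (-η) η)) ∩ O ∩ Λ ⁻¹' c.source
    with hW_def
  have hWo : IsOpen W := by
    have h1 : IsOpen ((Ioo (p₀.1 - 1 / 2) (p₀.1 + 1 / 2) ×ˢ (Ioo (-1 : ℝ) 1 ×ˢ Ioo (-η) η)) ∩ O) :=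
      ((isOpen_Ioo.prod (isOpen_Ioo.prod isOpen_Ioo)).inter hO)
    have h2 : ContinuousOn Λ ((Ioo (p₀.1 - 1 / 2) (p₀.1 + 1 / 2) ×ˢ (Ioo (-1 : ℝ) 1 ×ˢ Ioo (-η) η)) ∩ O) :=
      hΛc.mono fun p hp => hOB hp.2
    exact h2.isOpen_inter_preimage h1 c.open_source
  have hp₀W : p₀ ∈ W :=
    ⟨⟨⟨⟨by linarith, by linarith⟩, (hOB hp₀).2⟩, hp₀⟩, mem_chart_source _ _⟩
  have hWsub : W ⊆ O := fun p hp => hp.1.2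
  -- in the chart, `Λ` is a continuous injection of the open set `W ⊆ ℝ³` into `ℝ³`
  set f : ℝ × ℝ × ℝ → EuclideanSpace ℝ (Fin 3) := fun p => c (Λ p) with hf_def
  have hfc : ContinuousOn f W := by
    refine c.continuousOn.comp (hΛc.mono fun p hp => hOB (hWsub hp)) fun p hp => hp.2
  have hfi : InjOn f W := by
    intro p hp p' hp' hpp'
    have h1 : Λ p = Λ p' := c.injOn hp.2 hp'.2 hpp'
    exact box_injOn_window hΛ1 hΛi p₀.1 hp.1.1 hp'.1.1 h1
  have hdim : Module.finrank ℝ (ℝ × ℝ × ℝ) = Module.finrank ℝ (EuclideanSpace ℝ (Fin 3)) := by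
    rw [finrank_euclideanSpace_fin, Module.finrank_prod, Module.finrank_prod, Module.finrank_self]
  have hopen : IsOpen (f '' W) :=
    Literature.Topology.Euclidean.Brouwer.isOpen_image_of_injOn hdim hWo hfc hfi
  -- back in `M`
  have hsub : f '' W ⊆ c.target := by
    rintro _ ⟨p, hp, rfl⟩
    exact c.map_source hp.2
  have hopen' : IsOpen (c.symm '' (f '' W)) := c.symm.isOpen_image_of_subset_source hopen hsub
  have heq : c.symm '' (f '' W) = Λ '' W := by
    rw [image_image]
    refine image_congr fun p hp => ?_
    exact c.left_inv hp.2
  rw [heq] at hopen'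
  exact mem_of_superset (hopen'.mem_nhds ⟨p₀, hp₀W, rfl⟩) (image_mono hWsub)

/-- The image of a neighbourhood of a point of the box is a neighbourhood of its image. [folklore] -/
theorem image_mem_nhds_box (hΛc : ContinuousOn Λ (univ ×ˢ (Ioo (-1 : ℝ) 1 ×ˢ Ioo (-η) η)))
    (hΛ1 : ∀ u r σ, Λ (u + 1, r, σ) = Λ (u, r, σ))
    (hΛi : InjOn Λ (Ico (0 : ℝ) 1 ×ˢ (Ioo (-1 : ℝ) 1 ×ˢ Ioo (-η) η))) {p₀ : ℝ × ℝ × ℝ}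
    (hp₀ : p₀.2 ∈ Ioo (-1 : ℝ) 1 ×ˢ Ioo (-η) η) {N : Set (ℝ × ℝ × ℝ)} (hN : N ∈ 𝓝 p₀) :
    Λ '' N ∈ 𝓝 (Λ p₀) := by
  have hB : IsOpen (univ ×ˢ (Ioo (-1 : ℝ) 1 ×ˢ Ioo (-η) η) : Set (ℝ × ℝ × ℝ)) :=
    isOpen_univ.prod (isOpen_Ioo.prod isOpen_Ioo)
  have h1 : IsOpen (Λ '' (interior N ∩ univ ×ˢ (Ioo (-1 : ℝ) 1 ×ˢ Ioo (-η) η))) :=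
    isOpen_image_box hΛc hΛ1 hΛi (isOpen_interior.inter hB) inter_subset_right
  exact mem_of_superset (h1.mem_nhds ⟨p₀, ⟨mem_interior_iff_mem_nhds.2 hN, trivial, hp₀⟩, rfl⟩)
    (image_mono fun p hp => interior_subset hp.1)

/-! ## §3 Reading a periodic function through the chart -/

/-- **Reading through the chart is continuous.**  Let `F` be continuous on the box and `1`-periodic in
the first variable, and let `P y` be, for `y` in a set `S ⊆ Λ(box)`, a preimage of `y` in the box.  Then
`y ↦ F (P y)` is continuous on `S` (whatever the choice of preimages). [folklore] -/
theorem continuousOn_read_box {Z : Type*} [TopologicalSpace Z]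
    (hΛc : ContinuousOn Λ (univ ×ˢ (Ioo (-1 : ℝ) 1 ×ˢ Ioo (-η) η)))
    (hΛ1 : ∀ u r σ, Λ (u + 1, r, σ) = Λ (u, r, σ))
    (hΛi : InjOn Λ (Ico (0 : ℝ) 1 ×ˢ (Ioo (-1 : ℝ) 1 ×ˢ Ioo (-η) η)))
    {F : ℝ × ℝ × ℝ → Z} (hF : ContinuousOn F (univ ×ˢ (Ioo (-1 : ℝ) 1 ×ˢ Ioo (-η) η)))
    (hF1 : ∀ u r σ, F (u + 1, r, σ) = F (u, r, σ)) {S : Set M} {P : M → ℝ × ℝ × ℝ}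
    (hP : ∀ y ∈ S, (P y).2 ∈ Ioo (-1 : ℝ) 1 ×ˢ Ioo (-η) η) (hPΛ : ∀ y ∈ S, Λ (P y) = y) :
    ContinuousOn (fun y => F (P y)) S := by
  have hFint : ∀ (m : ℤ) (u r σ : ℝ), F (u + m, r, σ) = F (u, r, σ) := fun m u r σ =>
    box_periodic_int (Λ := F) hF1 m u r σ
  intro y₀ hy₀
  rw [ContinuousWithinAt, tendsto_nhds]
  intro U hU hU0
  have hB : (univ ×ˢ (Ioo (-1 : ℝ) 1 ×ˢ Ioo (-η) η) : Set (ℝ × ℝ × ℝ)) ∈ 𝓝 (P y₀) :=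
    (isOpen_univ.prod (isOpen_Ioo.prod isOpen_Ioo)).mem_nhds ⟨trivial, hP y₀ hy₀⟩
  have hN : F ⁻¹' U ∩ univ ×ˢ (Ioo (-1 : ℝ) 1 ×ˢ Ioo (-η) η) ∈ 𝓝 (P y₀) := by
    have h1 : ContinuousAt F (P y₀) := (hF (P y₀) ⟨trivial, hP y₀ hy₀⟩).continuousAt hB
    exact inter_mem (h1.preimage_mem_nhds (hU.mem_nhds hU0)) hB
  have hmem := image_mem_nhds_box hΛc hΛ1 hΛi (hP y₀ hy₀) hN
  rw [hPΛ y₀ hy₀] at hmem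
  filter_upwards [mem_nhdsWithin_of_mem_nhds hmem, self_mem_nhdsWithin] with y hy hyS
  obtain ⟨p, ⟨hpU, -, hp2⟩, hpy⟩ := hy
  show F (P y) ∈ U
  obtain ⟨h2, m, hm⟩ := box_eq_iff hΛ1 hΛi hp2 (hP y hyS) (hpy.trans (hPΛ y hyS).symm)
  have e : P y = (p.1 + m, p.2.1, p.2.2) := by
    rw [← hm]
    exact Prod.ext rfl h2.symm
  rw [e, hFint]
  exact hpU

end CrossBox

open CrossBox

/-! ## The registered form -/

/-- **Sub-goal `helper_boxChart_isOpen_image`** (J4, bridge (e×) of the N1 contract, tool 2, fully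
qualified): a continuous, `1`-periodic box chart of a `3`-manifold, injective on
`[0, 1) × (−1, 1) × (−η, η)`, maps open subsets of the box `ℝ × (−1, 1) × (−η, η)` to open sets.
[cite: Tao2014, Thm. 6.0.12] -/
theorem helper_boxChart_isOpen_image : ∀ (M : Type) [TopologicalSpace M] [ChartedSpace (EuclideanSpace ℝ (Fin 3)) M] (Λ : ℝ × ℝ × ℝ → M) (η : ℝ), ContinuousOn Λ (Set.univ ×ˢ (Set.Ioo (-1 : ℝ) 1 ×ˢ Set.Ioo (-η) η)) → (∀ u r σ, Λ (u + 1, r, σ) = Λ (u, r, σ)) → Set.InjOn Λ (Set.Ico (0 : ℝ) 1 ×ˢ (Set.Ioo (-1 : ℝ) 1 ×ˢ Set.Ioo (-η) η)) → ∀ (O : Set (ℝ × ℝ × ℝ)), IsOpen O → O ⊆ Set.univ ×ˢ (Set.Ioo (-1 : ℝ) 1 ×ˢ Set.Ioo (-η) η) → IsOpen (Λ '' O) :=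
  fun _ _ _ _ _ hΛc hΛ1 hΛi _ hO hOB => isOpen_image_box hΛc hΛ1 hΛi hO hOB

end Summit.SmoothPoincare4.SmoothPoincare4.Theorems.AcyclicBisectionExists.ModpBraidOrbits

end
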